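import Literature.NumberTheory.Weil1964.ArchSiegelGaussianAction
import Literature.Analysis.SpecialFunctions.RealGaussianComplexQuadratic
import HarnessLib

/-!
# The Gaussians `e^{πi x·τx} ∈ 𝓢(ℝ^σ)`, `τ ∈ 𝔥_σ`, and the Siegel-parabolic generators on them (Folland §4.5)

Topic `NumberTheory/Weil1964`; namespace `Literature.NumberTheory.Weil1964`.  KERNEL throughout: definitions with
bodies and proved theorems only — no records, no `sorry`, no cited hypothesis.

File 2 of the Schrödinger-model «Gaussian-orbit» proof of Folland's Thm. (4.37) (records R1/R2 of
`ArchMetaplecticDoubleCover`; row B07-3 of the pub-hodgecm2 literature fan-out; the «Gaussian stability» part of row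
B07-2 rides here by the lead's one-writer rule):

* §1 complex coordinates `cvec x = (x_k)_k ∈ ℂ^σ`, the Gaussian FUNCTION `gaussFun τ x = exp(πi ᵗx τ x)` and the
  closure properties of `𝔥_σ` used by the generators: `τ − b ∈ 𝔥` (`b` real symmetric), `τ + i1 ∈ 𝔥`, `ᵗSτS ∈ 𝔥`
  (`S` real invertible), `−τ⁻¹ ∈ 𝔥`;
* §2 the Gaussian as a SCHWARTZ FUNCTION `gaussS τ ∈ 𝓢(ℝ^σ)` [Folland (4.62): «for `τ ∈ 𝔥ₙ` the function `e^{πi xτx}`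
  is in `𝓢`»] — constructed with no analysis at all as `c · chirpS(−Re τ) (leviS a k₀)` for a real `a` with
  `ᵗ(a⁻¹)(a⁻¹) = Im τ` and the vacuum `k₀ = h₀ = 2^{n/4}e^{−π|x|²}`, then identified pointwise (`gaussS_apply`); the
  vacuum is the Gaussian at the base point: `h₀ = 2^{n/4} · gaussS (i1)` (`hermitePi_zero_eq_smul_gaussS`);
* §3 the two Siegel-parabolic generators of `Mp^𝓢(W)` act on Gaussians through the action of file 1
  [Folland (4.65) / Thm. (4.64)]: `chirpS b (gaussS τ) = gaussS (τ − b) = gaussS (n(b) ⋆ τ)` and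
  `leviS a (gaussS τ) = |det a|^{-1/2} gaussS (ᵗ(a⁻¹) τ a⁻¹) = |det a|^{-1/2} gaussS (m(a,d) ⋆ τ)`.

The Fourier transform of `gaussS τ` (the third generator) and the overlap `⟪h₀, gaussS τ⟫` are file 3
(`ArchGaussianFourier`).

## References

* [Folland1989] G. B. Folland, *Harmonic Analysis in Phase Space*, Princeton UP 1989, §4.5 (4.62)–(4.65), Thm. (4.64)
  (the Gaussians `e^{πi xτx}` and the action of the metaplectic generators on them), §4.2 (4.24)–(4.25), §1.7 (`h₀`).
-/

set_option autoImplicit false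

noncomputable section

open Complex Matrix MeasureTheory SchwartzMap
open scoped ComplexOrder ComplexConjugate Real

namespace Literature.NumberTheory.Weil1964

open Literature.Analysis.SegalBargmann Literature.RepresentationTheory.HeisenbergGroup
  Literature.Analysis.SpecialFunctions

variable {σ : Type*} [Fintype σ] [DecidableEq σ]

local notation "SR" σ => SchwartzMap (σ → ℝ) ℂ
local notation "PV" σ => (σ → ℝ) × (σ → ℝ)
local notation "SpR" σ => symplecticGroup (polar (dotPairing σ))
/-- complexification of a real matrix -/
local notation "RC" => RingHom.mapMatrix (m := σ) Complex.ofRealHom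

/-! ## 1. Complex coordinates, the Gaussian function, closure properties of `𝔥_σ` -/

/-- Complex coordinates of a real vector: `cvec x = (x_k)_k ∈ ℂ^σ`. [cite: Folland1989, §4.5 (4.62)] -/
def cvec (x : σ → ℝ) : σ → ℂ := fun k => (x k : ℂ)

omit [Fintype σ] [DecidableEq σ] in
/-- Unfolding. [cite: Folland1989, §4.5 (4.62)] -/
@[simp] theorem cvec_apply (x : σ → ℝ) (k : σ) : cvec x k = (x k : ℂ) := rfl

/-- `cvec (T y) = (RC T) (cvec y)`. [cite: Folland1989, §4.5 (4.65)] -/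
theorem cvec_mulVec (T : Matrix σ σ ℝ) (y : σ → ℝ) : cvec (T *ᵥ y) = RC T *ᵥ cvec y := by
  funext i
  exact RingHom.map_mulVec Complex.ofRealHom T y i

omit [DecidableEq σ] in
/-- `cvec x · cvec v = x · v`. [cite: Folland1989, §4.5 (4.62)] -/
theorem cvec_dotProduct_cvec (x v : σ → ℝ) : cvec x ⬝ᵥ cvec v = ((x ⬝ᵥ v : ℝ) : ℂ) := by
  simp only [dotProduct, cvec_apply]
  push_cast
  rfl

omit [DecidableEq σ] in
/-- Transport of a complex quadratic form under a linear substitution: `ᵗ(Tv) M (Tv) = ᵗv (ᵗT M T) v`.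
[cite: Folland1989, §4.5 (4.65)] -/
theorem dotProduct_mulVec_mulVec_eq_complex (T M : Matrix σ σ ℂ) (v : σ → ℂ) :
    (T *ᵥ v) ⬝ᵥ (M *ᵥ (T *ᵥ v)) = v ⬝ᵥ ((Tᵀ * M * T) *ᵥ v) := by
  rw [Matrix.mulVec_mulVec, ← Matrix.vecMul_transpose, ← Matrix.dotProduct_mulVec, Matrix.mulVec_mulVec,
    Matrix.mul_assoc]

omit [DecidableEq σ] in
/-- For real `x` and complex `M`: `ᵗx M x = ᵗx (Re M) x + i ᵗx (Im M) x` (tree lemma `dotProduct_mulVec_ofReal_eq` in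
`cvec` notation). [cite: Folland1989, §4.5 (4.62)] -/
theorem cvec_dotProduct_mulVec_cvec (M : Matrix σ σ ℂ) (x : σ → ℝ) :
    cvec x ⬝ᵥ (M *ᵥ cvec x) =
      ((x ⬝ᵥ (M.map Complex.re *ᵥ x) : ℝ) : ℂ) + I * ((x ⬝ᵥ (M.map Complex.im *ᵥ x) : ℝ) : ℂ) :=
  dotProduct_mulVec_ofReal_eq M x

/-- **The Gaussian function** `gaussFun τ x = exp(πi ᵗx τ x)`. [cite: Folland1989, §4.5 (4.62)] -/
def gaussFun (τ : Matrix σ σ ℂ) (x : σ → ℝ) : ℂ := cexp (π * I * (cvec x ⬝ᵥ (τ *ᵥ cvec x)))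

omit [DecidableEq σ] in
/-- Unfolding. [cite: Folland1989, §4.5 (4.62)] -/
theorem gaussFun_apply (τ : Matrix σ σ ℂ) (x : σ → ℝ) :
    gaussFun τ x = cexp (π * I * (cvec x ⬝ᵥ (τ *ᵥ cvec x))) := rfl

/-- `τ = Re τ + i Im τ` in matrix form. [cite: Folland1989, §4.5 (4.62)] -/
theorem RC_re_add_I_smul_RC_im (τ : Matrix σ σ ℂ) : RC (τ.map Complex.re) + I • RC (τ.map Complex.im) = τ := by
  ext i j
  simp only [Matrix.add_apply, Matrix.smul_apply, RingHom.mapMatrix_apply, Matrix.map_apply, smul_eq_mul,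
    Complex.ofRealHom_eq_coe]
  rw [mul_comm]
  exact Complex.re_add_im (τ i j)

/-- `Re (P + iQ) = P`, `Im (P + iQ) = Q` for real `P, Q`. [cite: Folland1989, §4.5 (4.62)] -/
theorem map_re_im_RC_add_I_smul_RC (P Q : Matrix σ σ ℝ) :
    (RC P + I • RC Q).map Complex.re = P ∧ (RC P + I • RC Q).map Complex.im = Q := by
  constructor
  · ext i j
    simp [Matrix.map_apply, RingHom.mapMatrix_apply]
  · ext i j
    simp [Matrix.map_apply, RingHom.mapMatrix_apply]

/-- **`𝔥_σ` is stable under `τ ↦ τ − b`** for real symmetric `b` (the unipotent `n(b)`). [cite: Folland1989, §4.5 (4.65)] -/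
theorem sub_RC_mem_siegelH {τ : Matrix σ σ ℂ} (hτ : τ ∈ siegelH σ) {B : Matrix σ σ ℝ} (hB : B.IsSymm) :
    τ - RC B ∈ siegelH σ := by
  refine ⟨hτ.1.sub (hB.map _), ?_⟩
  have h : (τ - RC B).map Complex.im = τ.map Complex.im := by
    ext i j
    simp [Matrix.map_apply, RingHom.mapMatrix_apply]
  rw [h]
  exact hτ.2

omit [Fintype σ] in
/-- **`𝔥_σ` is stable under `τ ↦ τ + i1`** (the shift hidden in `⟪h₀, e^{πi xτx}⟫ = ∫ e^{πi x(τ + i)x}`).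
[cite: Folland1989, §4.5 (4.62)] -/
theorem add_I_smul_one_mem_siegelH {τ : Matrix σ σ ℂ} (hτ : τ ∈ siegelH σ) : τ + I • 1 ∈ siegelH σ := by
  refine ⟨hτ.1.add (I_smul_one_mem_siegelH (σ := σ)).1, ?_⟩
  have h : (τ + I • (1 : Matrix σ σ ℂ)).map Complex.im = τ.map Complex.im + 1 := by
    ext i j
    by_cases hij : i = j
    · subst hij; simp
    · simp [hij]
  rw [h]
  exact hτ.2.add_posSemidef Matrix.PosSemidef.one

/-- **`𝔥_σ` is stable under real congruence `τ ↦ ᵗS τ S`**, `S` real invertible (the Levi elements).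
[cite: Folland1989, §4.5 (4.65)] -/
theorem transpose_mul_mul_mem_siegelH {τ : Matrix σ σ ℂ} (hτ : τ ∈ siegelH σ) {S : Matrix σ σ ℝ}
    (hS : S.det ≠ 0) : (RC S)ᵀ * τ * RC S ∈ siegelH σ := by
  have hdec : (RC S)ᵀ * τ * RC S = RC (Sᵀ * τ.map Complex.re * S) + I • RC (Sᵀ * τ.map Complex.im * S) := by
    conv_lhs => rw [← RC_re_add_I_smul_RC_im τ]
    rw [Matrix.mul_add, Matrix.add_mul, Matrix.mul_smul, Matrix.smul_mul, map_mul, map_mul, map_mul, map_mul]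
    rfl
  refine ⟨?_, ?_⟩
  · show ((RC S)ᵀ * τ * RC S)ᵀ = (RC S)ᵀ * τ * RC S
    rw [Matrix.transpose_mul, Matrix.transpose_mul, Matrix.transpose_transpose, hτ.1.eq, Matrix.mul_assoc]
  · rw [hdec, (map_re_im_RC_add_I_smul_RC _ _).2]
    have hinj : Function.Injective S.mulVec :=
      Matrix.mulVec_injective_of_isUnit ((Matrix.isUnit_iff_isUnit_det _).2 hS.isUnit)
    have h := hτ.2.conjTranspose_mul_mul_same hinj
    rwa [Matrix.conjTranspose_eq_transpose_of_trivial] at h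

/-- **`𝔥_σ` is stable under `τ ↦ −τ⁻¹`** (the Weyl element / Fourier transform; from file 1's `sact_mem` at the
realified `i·1`). [cite: Folland1989, §4.5 (4.65)] -/
theorem neg_inv_mem_siegelH {τ : Matrix σ σ ℂ} (hτ : τ ∈ siegelH σ) : -τ⁻¹ ∈ siegelH σ := by
  have h := Sp.sact_mem (MpS.proj (MpS.unitary (diagHom fun _ : σ => Circle.exp (π / 2)))) hτ
  rwa [(Sp.sact_weyl _ MpS.coe_proj_unitary_I τ).2.2.1] at h

/-! ## 2. The Gaussian `e^{πi xτx}` as a Schwartz function -/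

/-- A real square root datum of `Im τ`: an invertible real `S` with `ᵗS S = Im τ` (chosen). [cite: Folland1989, §4.5 (4.62)] -/
private def sqrtIm {τ : Matrix σ σ ℂ} (hτ : τ ∈ siegelH σ) : Matrix σ σ ℝ :=
  Classical.choose (exists_eq_transpose_mul_self_of_posDef hτ.2)

/-- `det S ≠ 0`. [cite: Folland1989, §4.5 (4.62)] -/
private theorem sqrtIm_det_ne_zero {τ : Matrix σ σ ℂ} (hτ : τ ∈ siegelH σ) : (sqrtIm hτ).det ≠ 0 :=
  (Classical.choose_spec (exists_eq_transpose_mul_self_of_posDef hτ.2)).1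

/-- `ᵗS S = Im τ`. [cite: Folland1989, §4.5 (4.62)] -/
private theorem transpose_sqrtIm_mul_sqrtIm {τ : Matrix σ σ ℂ} (hτ : τ ∈ siegelH σ) :
    (sqrtIm hτ)ᵀ * sqrtIm hτ = τ.map Complex.im :=
  (Classical.choose_spec (exists_eq_transpose_mul_self_of_posDef hτ.2)).2.symm

/-- The Levi datum `a = S⁻¹` (so that `leviS a f = |det a|^{-1/2} f ∘ S`). [cite: Folland1989, §4.2 (4.24)] -/
private def leviOf {τ : Matrix σ σ ℂ} (hτ : τ ∈ siegelH σ) : (σ → ℝ) ≃ₗ[ℝ] (σ → ℝ) :=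
  ((sqrtIm hτ).toLinearEquiv' ((sqrtIm hτ).invertibleOfIsUnitDet (sqrtIm_det_ne_zero hτ).isUnit)).symm

/-- `a⁻¹ x = S x`. [cite: Folland1989, §4.2 (4.24)] -/
private theorem leviOf_symm_apply {τ : Matrix σ σ ℂ} (hτ : τ ∈ siegelH σ) (x : σ → ℝ) :
    (leviOf hτ).symm x = sqrtIm hτ *ᵥ x := by
  rw [leviOf, LinearEquiv.symm_symm]
  change Matrix.toLin' (sqrtIm hτ) x = _
  exact Matrix.toLin'_apply _ _

open Classical in
/-- **The Gaussian `e^{πi xτx}` as an element of `𝓢(ℝ^σ)`** for `τ ∈ 𝔥_σ` (and `0` otherwise): by CONSTRUCTION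
`c · e^{πi x(Re τ)x} · (|det a|^{-1/2} h₀(S x))` with `ᵗSS = Im τ`, i.e. a chirp applied to a Levi dilate of the
vacuum — a Schwartz function with no estimate to prove. [cite: Folland1989, §4.5 (4.62)] -/
def gaussS (τ : Matrix σ σ ℂ) : SR σ :=
  if hτ : τ ∈ siegelH σ then
    ((leviFactor (leviOf hτ))⁻¹ * ((vacCoef σ : ℝ) : ℂ)⁻¹) •
      chirpS (-(Matrix.toLin' (τ.map Complex.re))) (leviS (leviOf hτ) (hermitePi 0))
  else 0

omit [DecidableEq σ] in
/-- `Σ_k (y_k)² = y · y` in `ℂ`. [cite: Folland1989, §1.7] -/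
private theorem sum_sq_eq_dotProduct (y : σ → ℝ) : ∑ k, ((y k : ℝ) : ℂ) ^ 2 = ((y ⬝ᵥ y : ℝ) : ℂ) := by
  simp only [dotProduct]
  push_cast
  exact Finset.sum_congr rfl fun k _ => sq _

/-- **Pointwise identification `gaussS τ x = e^{πi xτx}`** for `τ ∈ 𝔥_σ`. [cite: Folland1989, §4.5 (4.62)] -/
theorem gaussS_apply {τ : Matrix σ σ ℂ} (hτ : τ ∈ siegelH σ) (x : σ → ℝ) : gaussS τ x = gaussFun τ x := by
  have h1 : leviFactor (leviOf hτ) ≠ 0 := leviFactor_ne_zero _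
  have h2 : ((vacCoef σ : ℝ) : ℂ) ≠ 0 := Complex.ofReal_ne_zero.2 (vacCoef_pos (σ := σ)).ne'
  have key : ∀ E1 E2 : ℂ, (leviFactor (leviOf hτ))⁻¹ * ((vacCoef σ : ℝ) : ℂ)⁻¹ *
      (E1 * (leviFactor (leviOf hτ) * (((vacCoef σ : ℝ) : ℂ) * E2))) = E1 * E2 := fun E1 E2 => by
    field_simp
  have hSS : sqrtIm hτ *ᵥ x ⬝ᵥ sqrtIm hτ *ᵥ x = x ⬝ᵥ (τ.map Complex.im *ᵥ x) := by
    rw [Matrix.dotProduct_mulVec (sqrtIm hτ *ᵥ x) (sqrtIm hτ) x, ← Matrix.mulVec_transpose, Matrix.mulVec_mulVec,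
      transpose_sqrtIm_mul_sqrtIm, dotProduct_comm]
  rw [gaussS, dif_pos hτ, _root_.smul_apply, chirpS_apply, leviS_apply, hermitePi_apply, herm_zero,
    leviOf_symm_apply, smul_eq_mul, hermiteFun, vac, MvPolynomial.eval_C, gauss, chirpMul, chirpArg,
    LinearMap.neg_apply, Matrix.toLin'_apply, dotProduct_neg, sum_sq_eq_dotProduct, hSS, gaussFun_apply,
    cvec_dotProduct_mulVec_cvec, key, ← Complex.exp_add]
  congr 1
  push_cast
  linear_combination (-(π : ℂ) * ((x ⬝ᵥ (τ.map Complex.im *ᵥ x) : ℝ) : ℂ)) * I_sq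

/-- Off `𝔥_σ` the symbol `gaussS τ` is `0` (junk value). [cite: Folland1989, §4.5 (4.62)] -/
theorem gaussS_of_not_mem {τ : Matrix σ σ ℂ} (hτ : τ ∉ siegelH σ) : gaussS τ = 0 := by
  rw [gaussS, dif_neg hτ]

/-- **The vacuum is the Gaussian at the base point**: `h₀ = 2^{n/4} · gaussS (i1)` (`h₀(x) = 2^{n/4} e^{−π|x|²}`).
[cite: Folland1989, §1.7, §4.5 (4.62)] -/
theorem hermitePi_zero_eq_smul_gaussS :
    hermitePi (0 : σ →₀ ℕ) = ((vacCoef σ : ℝ) : ℂ) • gaussS (I • (1 : Matrix σ σ ℂ)) := by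
  ext x
  rw [hermitePi_apply, herm_zero, hermiteFun, vac, MvPolynomial.eval_C, gauss, _root_.smul_apply,
    gaussS_apply I_smul_one_mem_siegelH, gaussFun_apply, smul_eq_mul, Matrix.smul_mulVec, Matrix.one_mulVec,
    dotProduct_smul, smul_eq_mul]
  congr 2
  rw [← mul_assoc, mul_assoc (π : ℂ) I I, I_mul_I]
  simp only [dotProduct, cvec_apply, sq]
  ring

/-! ## 3. The Siegel-parabolic generators on Gaussians -/

/-- The matrix of a `dotPairing`-symmetric endomorphism is symmetric. [cite: Folland1989, §4.2 (4.25)] -/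
theorem isSymm_toMatrix'_of_dotPairing_symm (b : (σ → ℝ) →ₗ[ℝ] (σ → ℝ))
    (hb : ∀ x x', dotPairing σ x (b x') = dotPairing σ x' (b x)) : (LinearMap.toMatrix' b).IsSymm := by
  refine Matrix.IsSymm.ext fun i j => ?_
  rw [LinearMap.toMatrix'_apply, LinearMap.toMatrix'_apply]
  have h := hb (Pi.single j 1) (Pi.single i 1)
  rw [dotPairing_apply, dotPairing_apply, single_one_dotProduct, single_one_dotProduct] at h
  exact h

/-- **Chirps shift the parameter: `chirpS b (gaussS τ) = gaussS (τ − b)`** — the unipotent `n(b)` acts on Gaussians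
through `n(b) ⋆ τ = τ − b`. [cite: Folland1989, §4.5 (4.65), §4.2 (4.25)] -/
theorem chirpS_gaussS {τ : Matrix σ σ ℂ} (hτ : τ ∈ siegelH σ) (b : (σ → ℝ) →ₗ[ℝ] (σ → ℝ))
    (hb : ∀ x x', dotPairing σ x (b x') = dotPairing σ x' (b x)) :
    chirpS b (gaussS τ) = gaussS (τ - RC (LinearMap.toMatrix' b)) := by
  have hB := isSymm_toMatrix'_of_dotPairing_symm b hb
  ext x
  rw [chirpS_apply, gaussS_apply hτ, gaussS_apply (sub_RC_mem_siegelH hτ hB), chirpMul, chirpArg, gaussFun_apply,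
    gaussFun_apply, ← Complex.exp_add, Matrix.sub_mulVec, dotProduct_sub, ← cvec_mulVec, LinearMap.toMatrix'_mulVec,
    cvec_dotProduct_cvec]
  congr 1
  push_cast
  ring

/-- The same through file 1's action: `chirpS b (gaussS τ) = gaussS (n(b) ⋆ τ)`, with `j(n(b), τ) = 1`.
[cite: Folland1989, §4.5 (4.65)] -/
theorem chirpS_gaussS_eq_sact {τ : Matrix σ σ ℂ} (hτ : τ ∈ siegelH σ) (b : (σ → ℝ) →ₗ[ℝ] (σ → ℝ))
    (hb : ∀ x x', dotPairing σ x (b x') = dotPairing σ x' (b x)) :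
    chirpS b (gaussS τ) = gaussS (Sp.sact (unipotentSp (dotPairing σ) b hb) τ) := by
  rw [chirpS_gaussS hτ b hb, (Sp.sact_unipotentSp b hb τ).2.2.1]

/-- The matrix `S = [a⁻¹]` of the inverse of a Levi datum is invertible. [cite: Folland1989, §4.2 (4.24)] -/
theorem det_toMatrix'_symm_ne_zero (a : (σ → ℝ) ≃ₗ[ℝ] (σ → ℝ)) :
    (LinearMap.toMatrix' (a.symm : (σ → ℝ) →ₗ[ℝ] (σ → ℝ))).det ≠ 0 := by
  rw [LinearMap.det_toMatrix']
  exact (LinearEquiv.isUnit_det' a.symm).ne_zero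

/-- **Levi dilations conjugate the parameter: `leviS a (gaussS τ) = |det a|^{-1/2} · gaussS (ᵗS τ S)`, `S = [a⁻¹]`**
— the Levi element `m(a, ᵗa⁻¹)` acts on Gaussians through `m ⋆ τ = ᵗ(a⁻¹) τ a⁻¹`. [cite: Folland1989, §4.5 (4.65), §4.2 (4.24)] -/
theorem leviS_gaussS {τ : Matrix σ σ ℂ} (hτ : τ ∈ siegelH σ) (a : (σ → ℝ) ≃ₗ[ℝ] (σ → ℝ)) :
    leviS a (gaussS τ) = leviFactor a •
      gaussS ((RC (LinearMap.toMatrix' (a.symm : (σ → ℝ) →ₗ[ℝ] (σ → ℝ))))ᵀ * τ *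
        RC (LinearMap.toMatrix' (a.symm : (σ → ℝ) →ₗ[ℝ] (σ → ℝ)))) := by
  have hS := det_toMatrix'_symm_ne_zero a
  ext x
  rw [leviS_apply, _root_.smul_apply, smul_eq_mul, gaussS_apply hτ, gaussS_apply (transpose_mul_mul_mem_siegelH hτ hS),
    gaussFun_apply, gaussFun_apply]
  congr 3
  have hx : a.symm x = LinearMap.toMatrix' (a.symm : (σ → ℝ) →ₗ[ℝ] (σ → ℝ)) *ᵥ x := by
    rw [LinearMap.toMatrix'_mulVec]; rfl
  rw [hx, cvec_mulVec, dotProduct_mulVec_mulVec_eq_complex]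

/-- For a Levi pair `(a, d)` (`a x · d y = x · y`): `[d] = ᵗ[a⁻¹]` and `[a]⁻¹ = [a⁻¹]` over `ℂ`, so file 1's action reads
`m(a,d) ⋆ τ = ᵗS τ S` with `S = [a⁻¹]`. [cite: Folland1989, §4.5 (4.65), §4.2 (4.24)] -/
theorem sact_leviSp_eq (a d : (σ → ℝ) ≃ₗ[ℝ] (σ → ℝ)) (had : ∀ x y, dotPairing σ (a x) (d y) = dotPairing σ x y)
    (τ : Matrix σ σ ℂ) :
    Sp.sact (leviSp (dotPairing σ) a d had) τ =
      (RC (LinearMap.toMatrix' (a.symm : (σ → ℝ) →ₗ[ℝ] (σ → ℝ))))ᵀ * τ *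
        RC (LinearMap.toMatrix' (a.symm : (σ → ℝ) →ₗ[ℝ] (σ → ℝ))) := by
  set S : Matrix σ σ ℝ := LinearMap.toMatrix' (a.symm : (σ → ℝ) →ₗ[ℝ] (σ → ℝ)) with hSdef
  set Ma : Matrix σ σ ℝ := LinearMap.toMatrix' (a : (σ → ℝ) →ₗ[ℝ] (σ → ℝ)) with hMa
  -- `S * Ma = 1`
  have hSMa : S * Ma = 1 := by
    rw [hSdef, hMa, ← LinearMap.toMatrix'_mul]
    have : (a.symm : (σ → ℝ) →ₗ[ℝ] (σ → ℝ)) * (a : (σ → ℝ) →ₗ[ℝ] (σ → ℝ)) = LinearMap.id :=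
      LinearMap.ext fun x => a.symm_apply_apply x
    rw [this, LinearMap.toMatrix'_id]
  have hMaS : Ma * S = 1 := by
    rw [hSdef, hMa, ← LinearMap.toMatrix'_mul]
    have : (a : (σ → ℝ) →ₗ[ℝ] (σ → ℝ)) * (a.symm : (σ → ℝ) →ₗ[ℝ] (σ → ℝ)) = LinearMap.id :=
      LinearMap.ext fun x => a.apply_symm_apply x
    rw [this, LinearMap.toMatrix'_id]
  -- `[d] = Sᵀ` from `ᵗ[a] [d] = 1`
  have hd : LinearMap.toMatrix' (d : (σ → ℝ) →ₗ[ℝ] (σ → ℝ)) = Sᵀ := by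
    have h1 := Sp.transpose_mul_eq_one_of_levi a d had
    rw [← hMa] at h1
    have h2 : Sᵀ * Maᵀ = 1 := by rw [← Matrix.transpose_mul, hMaS, Matrix.transpose_one]
    calc LinearMap.toMatrix' (d : (σ → ℝ) →ₗ[ℝ] (σ → ℝ))
        = (Sᵀ * Maᵀ) * LinearMap.toMatrix' (d : (σ → ℝ) →ₗ[ℝ] (σ → ℝ)) := by rw [h2, Matrix.one_mul]
      _ = Sᵀ := by rw [Matrix.mul_assoc, h1, Matrix.mul_one]
  have hinv : (RC Ma)⁻¹ = RC S := Matrix.inv_eq_left_inv (by rw [← map_mul, hSMa, map_one])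
  rw [(Sp.sact_leviSp a d had τ).2.2.1, hd, ← hMa, hinv]
  rfl

/-- The same through file 1's action: `leviS a (gaussS τ) = |det a|^{-1/2} · gaussS (m(a,d) ⋆ τ)`, where
`j(m(a,d), τ) = det a`. [cite: Folland1989, §4.5 (4.65)] -/
theorem leviS_gaussS_eq_sact {τ : Matrix σ σ ℂ} (hτ : τ ∈ siegelH σ) (a d : (σ → ℝ) ≃ₗ[ℝ] (σ → ℝ))
    (had : ∀ x y, dotPairing σ (a x) (d y) = dotPairing σ x y) :
    leviS a (gaussS τ) = leviFactor a • gaussS (Sp.sact (leviSp (dotPairing σ) a d had) τ) := by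
  rw [leviS_gaussS hτ a, sact_leviSp_eq a d had τ]

/-- `|det a|^{-1/2}` squared times `det a` is the SIGN of `det a`: `(leviFactor a)² · det [a] = det[a] / |det[a]|`.
[cite: Folland1989, §4.2 (4.24)] -/
theorem leviFactor_sq_mul_det (a : (σ → ℝ) ≃ₗ[ℝ] (σ → ℝ)) :
    leviFactor a ^ 2 * ((LinearMap.toMatrix' (a : (σ → ℝ) →ₗ[ℝ] (σ → ℝ))).det : ℂ) =
      ((LinearMap.det (a : (σ → ℝ) →ₗ[ℝ] (σ → ℝ)) / |LinearMap.det (a : (σ → ℝ) →ₗ[ℝ] (σ → ℝ))| : ℝ) : ℂ) := by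
  rw [LinearMap.det_toMatrix', leviFactor, ← Complex.ofReal_pow, ← Complex.ofReal_mul]
  congr 1
  have hpos : 0 < |LinearMap.det (a : (σ → ℝ) →ₗ[ℝ] (σ → ℝ))| := abs_pos.2 (LinearEquiv.isUnit_det' a).ne_zero
  rw [← Real.rpow_natCast, ← Real.rpow_mul hpos.le]
  norm_num
  rw [Real.rpow_neg_one, div_eq_inv_mul]

end Literature.NumberTheory.Weil1964
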